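import Summits.BirchSwinnertonDyer.BirchSwinnertonDyer.Theorems.GenusKolyvaginAtTwoGenusPrimitiveSupplyAtTwoTwistSelmerTransferDownRat
import Summits.BirchSwinnertonDyer.Rank1Residual.X11b.CongruentSelmerTransferBounds
import HarnessLib

/-!
# Route `CMKolyvaginAtInertTwo`, crux `CMKolyvaginExactAtInertTwo` (stmt-BirchSwinnertonDyer-24277):
# the binder (lag) of the over-`ℚ` bit DISCHARGED modulo Poitou–Tate — the one-place count
# `[S^♯ : S_♭] = #E(ℚ_q)[2] = 2` at the prime `q = −d_K` of a prime Heegner field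

Seat `bsd-line-cmk2-p1` g8 (cell `bsd-print-cf2`); helper (`--supports stmt-BirchSwinnertonDyer-24277`);
fifth file of the over-`ℚ` bit. THEOREMS ONLY; no item is closed; BSD is not proved by this.

The over-`ℚ` descent (`…RationalDescentAtTwoClosed`) takes the binder (lag): «two relaxed-Selmer classes
of `H¹(ℚ, E[2])` (Selmer condition at every place except the finite place `u`) which are NOT strict at
`u` differ by a strict one». This is the one-place Poitou–Tate count `[S^♯ : S_♭] = #E(ℚ_u)[2]·#(ℤ_u/2)`
with `#E(ℚ_u)[2] = 2` — and BOTH are in the tree: the count is X11b's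
`CongruentTransfer.relIndex_kummerStrict_kummerRelaxed_singleton_eq_of_facts` (any number field, any
curve, any prime; modulo the PRINT named facts `poitouTate_selmerStructure_duality_real` — Milne ADT
I.4.10 with the real places — and `localEulerPoincareCharacteristic` — Tate, Milne I.2.8), and
`#E(ℚ_q)[2] = 2` for the prime `q = −d_K` of a prime Heegner field on `Δ_E < 0` is gk2-p5's
`GenusKolyTwin.natCard_twoTorsion_padic_eq_two_of_discr_eq_neg_prime` ((Δ_min/q) = sign Δ ⟹ exactly one
root of the `2`-division cubic mod `q` — the "`Frob_q` is a transposition" of the memo, proved). Here: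

* §1 `mem_selmerGroup_kummerRelaxed_singleton_iff`, `mem_selmerGroup_kummerStrict_singleton_iff` — the
  relaxed / strict predicates of the over-`ℚ` files ARE membership in the Selmer groups of X11b's
  `KummerPT.kummerRelaxed W 2 {u}` / `kummerStrict W 2 {u}` (bridge: the tree's
  `comap_localization_kummerSelmerStructure`, gk2-p5's `mem_torsionLocalKer_iff_localization_eq_zero_rat`).
* §2 `sub_mem_of_index_eq_two` (pure group theory) and `ratDescent_lag_of_facts` — **(lag) for any
  finite place `u ∤ 2` of `ℚ` with `#E(ℚ_u)[2] = 2`, modulo the two Poitou–Tate named facts**.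
* §3 `ratDescent_lag_of_discr_eq_neg_prime` — **(lag) at the place over `q` for `K = ℚ(√−q)` Heegner for
  `N_E`, `d_K = −q` odd, `Δ_E < 0`**, modulo the same two facts.

References: [MilneADT2006] I Thm. 2.8, Thm. 4.10; [MazurRubin2010] Lemma 3.2, Prop. 3.3;
[Howard2004HeegnerKolyvagin] Thm. 2.1.11; [GrossLMS1991] §1.
-/

-- single-conjunct summit: `Summit.BirchSwinnertonDyer.BirchSwinnertonDyer.…` repeats the name by design
set_option linter.dupNamespace false
set_option autoImplicit false

noncomputable section

open scoped Classical ContRepresentation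
open WeierstrassCurve NumberField IsDedekindDomain Field Function
open Literature.NumberTheory.GaloisRepresentations Literature.NumberTheory.EllipticCurves
open Literature.NumberTheory.GaloisRepresentations.DiscreteGaloisModule (SelmerStructure)
open Literature.NumberTheory.GaloisCohomology
open Summit.BirchSwinnertonDyer.Rank1Residual.X11b.KummerPT (kummerRelaxed kummerStrict
  kummerRelaxed_of_mem kummerRelaxed_of_not_mem kummerStrict_of_mem kummerStrict_of_not_mem
  kummerStrict_le_kummerRelaxed)
open Rat.HeightOneSpectrum (primesEquiv)

namespace Summit.BirchSwinnertonDyer.BirchSwinnertonDyer.Theorems.KolyvaginRatDescentTwo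

variable (W : WeierstrassCurve ℚ) [W.IsElliptic] (u : HeightOneSpectrum (𝓞 ℚ))

/-! ## §1 The relaxed / strict predicates are X11b's `kummerRelaxed` / `kummerStrict` Selmer groups -/

/-- `Sum.inr v ∉ {Sum.inr u}` for `v ≠ u`. [folklore] -/
private theorem inr_not_mem_singleton {v : HeightOneSpectrum (𝓞 ℚ)} (hv : v ≠ u) :
    (Sum.inr v : Place ℚ) ∉ ({Sum.inr u} : Finset (Place ℚ)) := by
  rw [Finset.mem_singleton]
  exact fun h ↦ hv (Sum.inr_injective h)

/-- `Sum.inl w ∉ {Sum.inr u}`. [folklore] -/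
private theorem inl_not_mem_singleton (w : InfinitePlace ℚ) :
    (Sum.inl w : Place ℚ) ∉ ({Sum.inr u} : Finset (Place ℚ)) := by
  rw [Finset.mem_singleton]
  exact Sum.inl_ne_inr

omit [W.IsElliptic] in
/-- **The RELAXED group `S^♯` of the over-`ℚ` files is `H¹_{𝓚^{u}}(ℚ, E[2])`**: a class of `H¹(ℚ, E[2])`
lies in the Selmer group of `kummerRelaxed W 2 {u}` iff it satisfies the Selmer local condition
(`selmerLocalKer`) at every finite place `v ≠ u` and at the infinite place.
[cite: Howard2004HeegnerKolyvagin, Def. 2.1.1 and Def. 2.1.10 (arXiv:1202.6340 p. 5)] -/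
theorem mem_selmerGroup_kummerRelaxed_singleton_iff (ξ : galH1Torsion W ((2 : ℕ) : ℤ)) :
    ξ ∈ (kummerRelaxed W 2 {(Sum.inr u : Place ℚ)}).selmerGroup ↔
      (∀ v : HeightOneSpectrum (𝓞 ℚ), v ≠ u → ξ ∈ selmerLocalKer W (v.adicCompletion ℚ) ((2 : ℕ) : ℤ)) ∧
        ∀ w : InfinitePlace ℚ, ξ ∈ selmerLocalKer W w.Completion ((2 : ℕ) : ℤ) := by
  -- `loc_v ξ ∈ 𝓚_v ↔ ξ ∈ selmerLocalKer (completion at v)` (the tree's comap identity, definitional `mem_comap`)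
  have key : ∀ v : Place ℚ,
      galoisCohomology.localization (W.torsionGaloisModule ((2 : ℕ) : ℤ)) v 1 ξ ∈
          W.kummerSelmerStructure ((2 : ℕ) : ℤ) v ↔
        ξ ∈ selmerLocalKer W (Place.Completion v) ((2 : ℕ) : ℤ) := fun v ↦
    SetLike.ext_iff.mp (W.comap_localization_kummerSelmerStructure ((2 : ℕ) : ℤ) v) ξ
  refine ((kummerRelaxed W 2 {(Sum.inr u : Place ℚ)}).mem_selmerGroup_iff ξ).trans ⟨fun h ↦ ?_, ?_⟩
  · refine ⟨fun v hv ↦ ?_, fun w ↦ ?_⟩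
    · have h' := h (Sum.inr v)
      rw [kummerRelaxed_of_not_mem W 2 _ (inr_not_mem_singleton u hv)] at h'
      exact (key (Sum.inr v)).mp h'
    · have h' := h (Sum.inl w)
      rw [kummerRelaxed_of_not_mem W 2 _ (inl_not_mem_singleton u w)] at h'
      exact (key (Sum.inl w)).mp h'
  · rintro ⟨h₁, h₂⟩ v
    rcases v with w | v
    · rw [kummerRelaxed_of_not_mem W 2 _ (inl_not_mem_singleton u w)]
      exact (key (Sum.inl w)).mpr (h₂ w)
    · by_cases hv : v = u
      · subst hv
        rw [kummerRelaxed_of_mem W 2 _ (Finset.mem_singleton_self _)]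
        exact AddSubgroup.mem_top _
      · rw [kummerRelaxed_of_not_mem W 2 _ (inr_not_mem_singleton u hv)]
        exact (key (Sum.inr v)).mpr (h₁ v hv)

/-- **The STRICT group `S_♭` is `H¹_{𝓚_{u}}(ℚ, E[2])`**: membership in the Selmer group of
`kummerStrict W 2 {u}` is the relaxed condition plus `ξ ∈ torsionLocalKer` at `u` (`loc_u ξ = 0`, gk2-p5's
`mem_torsionLocalKer_iff_localization_eq_zero_rat`). [cite: Howard2004HeegnerKolyvagin, Def. 2.1.1
(arXiv:1202.6340 p. 5)] [cite: McCallumLMS1991, §3 (3)] -/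
theorem mem_selmerGroup_kummerStrict_singleton_iff (ξ : galH1Torsion W ((2 : ℕ) : ℤ)) :
    ξ ∈ (kummerStrict W 2 {(Sum.inr u : Place ℚ)}).selmerGroup ↔
      ((∀ v : HeightOneSpectrum (𝓞 ℚ), v ≠ u → ξ ∈ selmerLocalKer W (v.adicCompletion ℚ) ((2 : ℕ) : ℤ)) ∧
          ∀ w : InfinitePlace ℚ, ξ ∈ selmerLocalKer W w.Completion ((2 : ℕ) : ℤ)) ∧
        ξ ∈ W.torsionLocalKer (u.adicCompletion ℚ) ((2 : ℕ) : ℤ) := by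
  have key : ∀ v : Place ℚ,
      galoisCohomology.localization (W.torsionGaloisModule ((2 : ℕ) : ℤ)) v 1 ξ ∈
          W.kummerSelmerStructure ((2 : ℕ) : ℤ) v ↔
        ξ ∈ selmerLocalKer W (Place.Completion v) ((2 : ℕ) : ℤ) := fun v ↦
    SetLike.ext_iff.mp (W.comap_localization_kummerSelmerStructure ((2 : ℕ) : ℤ) v) ξ
  have keyu := GenusKolyTwistLocal.mem_torsionLocalKer_iff_localization_eq_zero_rat W u ξ
  refine ((kummerStrict W 2 {(Sum.inr u : Place ℚ)}).mem_selmerGroup_iff ξ).trans ⟨fun h ↦ ?_, ?_⟩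
  · refine ⟨⟨fun v hv ↦ ?_, fun w ↦ ?_⟩, ?_⟩
    · have h' := h (Sum.inr v)
      rw [kummerStrict_of_not_mem W 2 _ (inr_not_mem_singleton u hv)] at h'
      exact (key (Sum.inr v)).mp h'
    · have h' := h (Sum.inl w)
      rw [kummerStrict_of_not_mem W 2 _ (inl_not_mem_singleton u w)] at h'
      exact (key (Sum.inl w)).mp h'
    · have h' := h (Sum.inr u)
      rw [kummerStrict_of_mem W 2 _ (Finset.mem_singleton_self _), AddSubgroup.mem_bot] at h'
      exact keyu.mpr h'
  · rintro ⟨⟨h₁, h₂⟩, h₃⟩ v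
    rcases v with w | v
    · rw [kummerStrict_of_not_mem W 2 _ (inl_not_mem_singleton u w)]
      exact (key (Sum.inl w)).mpr (h₂ w)
    · by_cases hv : v = u
      · subst hv
        rw [kummerStrict_of_mem W 2 _ (Finset.mem_singleton_self _), AddSubgroup.mem_bot]
        exact keyu.mp h₃
      · rw [kummerStrict_of_not_mem W 2 _ (inr_not_mem_singleton u hv)]
        exact (key (Sum.inr v)).mpr (h₁ v hv)

/-! ## §2 (lag) from the one-place Poitou–Tate count -/

/-- **Two elements outside a subgroup of index `2` differ by an element of it.** [folklore] -/
theorem sub_mem_of_index_eq_two {G : Type*} [AddCommGroup G] {H : AddSubgroup G} (hH : H.index = 2)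
    {x y : G} (hx : x ∉ H) (hy : y ∉ H) : x - y ∈ H := by
  obtain ⟨a, ha⟩ := AddSubgroup.index_eq_two_iff.mp hH
  have hxa : x + a ∈ H := ((ha x).or.resolve_right hx)
  have hya : y + a ∈ H := ((ha y).or.resolve_right hy)
  have h := H.sub_mem hxa hya
  rwa [add_sub_add_right_eq_sub] at h

/-- **(lag) of the over-`ℚ` bit, modulo Poitou–Tate**: for `E/ℚ` elliptic and a finite place `u ∤ 2` of `ℚ`
with `#E(ℚ_u)[2] = 2`, GIVEN the print facts `poitouTate_selmerStructure_duality_real ℚ` (Milne I.4.10)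
and `localEulerPoincareCharacteristic` at the finite places of `ℚ` (Tate, Milne I.2.8): two relaxed-Selmer
classes of `H¹(ℚ, E[2])` not strict at `u` differ by a strict one — because
`[H¹_{𝓚^{u}} : H¹_{𝓚_{u}}] = #E(ℚ_u)[2] · #(ℤ_u/2) = 2 · 1`
(X11b's `relIndex_kummerStrict_kummerRelaxed_singleton_eq_of_facts`). [cite: MilneADT2006, Ch. I,
Thm. 2.8 and Thm. 4.10] [cite: MazurRubin2010, Lemma 3.2 (arXiv:0904.3709 p. 10)] -/
theorem ratDescent_lag_of_facts (hPT : poitouTate_selmerStructure_duality_real ℚ)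
    (hEP : ∀ v : HeightOneSpectrum (𝓞 ℚ), localEulerPoincareCharacteristic (v.adicCompletion ℚ))
    (h2u : ((2 : ℕ) : 𝓞 ℚ) ∉ u.asIdeal)
    (ht : Nat.card (nsmulAddMonoidHom 2 :
      (W.baseChange (u.adicCompletion ℚ)).toAffine.Point →+ _).ker = 2) :
    ∀ ξ₁ ξ₂ : galH1Torsion W ((2 : ℕ) : ℤ),
      ((∀ v : HeightOneSpectrum (𝓞 ℚ), v ≠ u → ξ₁ ∈ selmerLocalKer W (v.adicCompletion ℚ) ((2 : ℕ) : ℤ)) ∧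
          ∀ w : InfinitePlace ℚ, ξ₁ ∈ selmerLocalKer W w.Completion ((2 : ℕ) : ℤ)) →
      ((∀ v : HeightOneSpectrum (𝓞 ℚ), v ≠ u → ξ₂ ∈ selmerLocalKer W (v.adicCompletion ℚ) ((2 : ℕ) : ℤ)) ∧
          ∀ w : InfinitePlace ℚ, ξ₂ ∈ selmerLocalKer W w.Completion ((2 : ℕ) : ℤ)) →
      ξ₁ ∉ W.torsionLocalKer (u.adicCompletion ℚ) ((2 : ℕ) : ℤ) →
      ξ₂ ∉ W.torsionLocalKer (u.adicCompletion ℚ) ((2 : ℕ) : ℤ) →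
      ξ₁ - ξ₂ ∈ W.torsionLocalKer (u.adicCompletion ℚ) ((2 : ℕ) : ℤ) := by
  haveI : Fact (Nat.Prime 2) := ⟨Nat.prime_two⟩
  intro ξ₁ ξ₂ h₁ h₂ hn₁ hn₂
  set R := (kummerRelaxed W 2 {(Sum.inr u : Place ℚ)}).selmerGroup with hR
  set S := (kummerStrict W 2 {(Sum.inr u : Place ℚ)}).selmerGroup with hS
  -- the one-place count: `[R : S] = 2`
  have hidx : (S.addSubgroupOf R).index = 2 := by
    have h := Rank1Residual.X11b.CongruentTransfer.relIndex_kummerStrict_kummerRelaxed_singleton_eq_of_facts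
      W 2 hPT hEP u
    rw [ht, GenusKolyTwistLocal.natCard_quotient_span_natCast_eq_one_of_not_mem u h2u, mul_one] at h
    exact h
  have hξ₁R : ξ₁ ∈ R := (mem_selmerGroup_kummerRelaxed_singleton_iff W u ξ₁).mpr h₁
  have hξ₂R : ξ₂ ∈ R := (mem_selmerGroup_kummerRelaxed_singleton_iff W u ξ₂).mpr h₂
  have hx : (⟨ξ₁, hξ₁R⟩ : R) ∉ S.addSubgroupOf R := fun h ↦
    hn₁ ((mem_selmerGroup_kummerStrict_singleton_iff W u ξ₁).mp (AddSubgroup.mem_addSubgroupOf.mp h)).2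
  have hy : (⟨ξ₂, hξ₂R⟩ : R) ∉ S.addSubgroupOf R := fun h ↦
    hn₂ ((mem_selmerGroup_kummerStrict_singleton_iff W u ξ₂).mp (AddSubgroup.mem_addSubgroupOf.mp h)).2
  have hsub := sub_mem_of_index_eq_two hidx hx hy
  rw [AddSubgroup.mem_addSubgroupOf, AddSubgroup.coe_sub] at hsub
  exact ((mem_selmerGroup_kummerStrict_singleton_iff W u (ξ₁ - ξ₂)).mp hsub).2

/-! ## §3 On the habitat: `K = ℚ(√−q)` a prime Heegner field, `Δ_E < 0` -/

/-- **(lag) at the place `u` over `q` for a prime Heegner field `K = ℚ(√−q)` on `Δ_E < 0`**, modulo the two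
Poitou–Tate named facts: `#E(ℚ_q)[2] = 2` is gk2-p5's
`GenusKolyTwin.natCard_twoTorsion_padic_eq_two_of_discr_eq_neg_prime` (`E/ℚ` globally minimal, `d_K = −q`
odd, Heegner for `N_E`, `Δ_E < 0`), transported to `ℚ_u` by `natCard_ker_nsmul_adicCompletion_eq_padic`.
[cite: MazurRubin2010, Lemma 2.2 (i), Lemma 3.2, Prop. 3.3] [cite: MilneADT2006, Ch. I, Thm. 2.8 and
Thm. 4.10] -/
theorem ratDescent_lag_of_discr_eq_neg_prime [W.IsGloballyMinimal] {K : Type} [Field K] [NumberField K]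
    (hPT : poitouTate_selmerStructure_duality_real ℚ)
    (hEP : ∀ v : HeightOneSpectrum (𝓞 ℚ), localEulerPoincareCharacteristic (v.adicCompletion ℚ))
    (hΔ : W.Δ < 0) (hK : IsImaginaryQuadratic K) (hodd : Odd (discr K))
    (hH : SatisfiesHeegnerHypothesis (W.conductorNorm ℤ) K) {q : ℕ} (hq : q.Prime)
    (hd : discr K = -(q : ℤ)) (hu : ((primesEquiv u : Nat.Primes) : ℕ) = q) :
    ∀ ξ₁ ξ₂ : galH1Torsion W ((2 : ℕ) : ℤ),
      ((∀ v : HeightOneSpectrum (𝓞 ℚ), v ≠ u → ξ₁ ∈ selmerLocalKer W (v.adicCompletion ℚ) ((2 : ℕ) : ℤ)) ∧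
          ∀ w : InfinitePlace ℚ, ξ₁ ∈ selmerLocalKer W w.Completion ((2 : ℕ) : ℤ)) →
      ((∀ v : HeightOneSpectrum (𝓞 ℚ), v ≠ u → ξ₂ ∈ selmerLocalKer W (v.adicCompletion ℚ) ((2 : ℕ) : ℤ)) ∧
          ∀ w : InfinitePlace ℚ, ξ₂ ∈ selmerLocalKer W w.Completion ((2 : ℕ) : ℤ)) →
      ξ₁ ∉ W.torsionLocalKer (u.adicCompletion ℚ) ((2 : ℕ) : ℤ) →
      ξ₂ ∉ W.torsionLocalKer (u.adicCompletion ℚ) ((2 : ℕ) : ℤ) →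
      ξ₁ - ξ₂ ∈ W.torsionLocalKer (u.adicCompletion ℚ) ((2 : ℕ) : ℤ) := by
  haveI : Fact q.Prime := ⟨hq⟩
  obtain ⟨hq2, -, -⟩ := GenusKolyTwin.prime_discr_facts W hK hodd hH hq hd
  have hqu : (q : 𝓞 ℚ) ∈ u.asIdeal := by
    rw [← hu]
    exact Rat.HeightOneSpectrum.natCast_natGenerator_mem u
  have h2u : ((2 : ℕ) : 𝓞 ℚ) ∉ u.asIdeal :=
    GenusKolyTwistingPrime.natCast_not_mem_of_not_dvd hq hqu fun h ↦
      hq2 ((Nat.prime_dvd_prime_iff_eq hq Nat.prime_two).mp h)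
  have ht : Nat.card (nsmulAddMonoidHom 2 :
      (W.baseChange (u.adicCompletion ℚ)).toAffine.Point →+ _).ker = 2 := by
    rw [GenusKolyTwistLocal.natCard_ker_nsmul_adicCompletion_eq_padic W u 2]
    subst hu
    exact GenusKolyTwin.natCard_twoTorsion_padic_eq_two_of_discr_eq_neg_prime W hK hodd hH hd hΔ
  exact ratDescent_lag_of_facts W u hPT hEP h2u ht

end Summit.BirchSwinnertonDyer.BirchSwinnertonDyer.Theorems.KolyvaginRatDescentTwo

end
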